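import Mathlib
import HarnessLib
import Summits.HubbardSuperconductivity.HubbardSuperconductivity.Theorems.KLProgrammeKLRegimeEnginePairTransferK5Private
import Summits.HubbardSuperconductivity.HubbardSuperconductivity.Theorems.KLProgrammeKLRegimeEngineV8PairTransferExport6

/-!
# Route `KLProgramme` — ENGINE child gen 8 (stmt-HubbardSuperconductivity-20437 `KLRegimeEngineV17F2`), skeleton v2 stub (X).3 / class #5 at Export6 (rev 12 «…-CAP6»):
# the producer-side doors RE-KEYED to the G-parametric step `PairTransferStep6 P R Q₀ G r u`
# (cell gate-hubbard-kl, seat hubbard-kl-k3c1-p1 g11, technique «composed-map remainder propagation»; Export6 = k3c2-p2's p595611, rulings (R96)/(R99)/(R100))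

WHY.  Located items «(X).3-CAP-MISSING» / «(X).3-∀G» (k3c2-p2 g14) changed stub (X).3's class-#5 conjunct to
`∃ e, IsTransferPkg6 e ∧ PairTransferStep6 P R (klEngQ7 P R) klEngGeo10 e.1 e.2`: the step now takes the geometry package `G` as a PARAMETER (`G.WF` its first binder,
`PairTransferStep5`'s body byte-verbatim otherwise) and the witness is CAPPED (`e.1 ≤ klCTcap = 2⁻¹⁹`).  The producer doors of this lineage were keyed on the `∀ G` step
`PairTransferStep5` (`pairTransferStep5_of_base_and_succ`, `pairTransferStep5_of_private`); a `∀ G` proof still serves (`PairTransferStep5.toStep6`) but is not what the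
analysis delivers (the relative bar's thermal slot needs `G.CF`'s floor).  This file gives the same doors AT A FIXED `G`:
* **`pairTransferStep6_of_base_and_succ`** — `PairTransferStep6 P R Q₀ G r u` from a BASE clause (the K5 family at `n = 0`) and a STEP clause (`K5 n → K5 (n+1)`), both under
  Step6's binders at their scale and AT `G`;
* **`pairTransferStep6_of_private`** — `PairTransferStep6 P R Q₀ G r u` from `R.WF2`, the bare frame's admissibility `h0`, a private predicate `Priv Q cc μ U β L M n` with
  BASE / STEP / EXPORT clauses at `G` (the handed `∀ j < n` history is not read; the binders at every `j ≤ n` are re-derived from those at `n`, as in `pairTransferStep5_of_private`);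
* **`exists_isTransferPkg6_of_step6`** — the (X).3 conjunct `∃ e, IsTransferPkg6 e ∧ PairTransferStep6 P R Q₀ G e.1 e.2` from a capped witness `0 ≤ r ≤ klCTcap`,
  `0 < u Q cc`, and the step at `(r, u)`.
Plumbing only; nothing about the model is asserted; nothing asserts any stub, K3 or superconductivity.  0 kit · 0 lit.
-/

noncomputable section

namespace Summit.HubbardSuperconductivity.HubbardSuperconductivity.Theorems.KLRegimeSplit

set_option linter.dupNamespace false -- summit = problem name (single-conjunct summit), D-0017

open Finset Matrix Set Literature.MathematicalPhysics.QuantumLattice Literature.Probability.LatticeModels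
open Literature.MathematicalPhysics.QuantumLattice.FermiRG
open Summit.HubbardSuperconductivity.HubbardSuperconductivity.Theorems.KLProgrammeLegKernels
open Summit.HubbardSuperconductivity.HubbardSuperconductivity.Theorems.DispersionFlow
open Summit.HubbardSuperconductivity.HubbardSuperconductivity.Theorems.EngineV8

/-! ## §1 `PairTransferStep6` = BASE + STEP at the package `G` -/

section Step6

/-- **`pairTransferStep6_of_base_and_succ`** — the (X).3 class-#5 step AT `G` from a BASE clause (the family at `n = 0` under Step6's binders) and a STEP clause
(`…K5 n → …K5 (n+1)` under Step6's binders at `n+1`).  Both clauses carry `PairTransferStep6`'s binder list verbatim at their scale, `G` fixed. -/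
theorem pairTransferStep6_of_base_and_succ {P : SplitConsts} {R : RenConsts} {Q₀ : EngConsts} {G : GeoConsts} {r : ℝ} {u : EngConsts → ℝ → ℝ}
    (hbase : G.WF → ∀ Q : EngConsts, Q₀.IsRaiseOf Q →
      ∀ cc : ℝ, 0 < cc → cc ≤ klEngC₃6 P R →
        ∀ μ ∈ klWindowC, ∀ U : ℝ, 0 < U → U ≤ klEngU₀10 P R cc → U ≤ u Q cc →
          ∀ β : ℝ, klBetaMin ≤ β → β ≤ Real.exp (cc / U ^ 2) →
            ∀ (L M : ℕ) [NeZero L] [NeZero M], klEngL₄ P R β U ≤ L → klEngM₃ β U L ≤ M →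
              0 ≤ nScales β + 1 → IsKLRegime U cc (-((0 : ℕ) : ℤ)) →
                HistP klPredsV17F2 L M G P Q R β U μ 0 0 →
                  FrameOK R U (nScales β) μ (klFlowFrameU L M β U μ 0) →
                    (∀ j ≤ 0, LevelsUExportMixedAt L M (klCU2 P R Q₀) P β U μ j) →
                      PairTransferRelFamilyK5 L M G P r β U μ 0)
    (hsucc : G.WF → ∀ Q : EngConsts, Q₀.IsRaiseOf Q →
      ∀ cc : ℝ, 0 < cc → cc ≤ klEngC₃6 P R →
        ∀ μ ∈ klWindowC, ∀ U : ℝ, 0 < U → U ≤ klEngU₀10 P R cc → U ≤ u Q cc →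
          ∀ β : ℝ, klBetaMin ≤ β → β ≤ Real.exp (cc / U ^ 2) →
            ∀ (L M : ℕ) [NeZero L] [NeZero M], klEngL₄ P R β U ≤ L → klEngM₃ β U L ≤ M →
              ∀ n : ℕ, n + 1 ≤ nScales β + 1 → IsKLRegime U cc (-((n + 1 : ℕ) : ℤ)) →
                HistP klPredsV17F2 L M G P Q R β U μ 0 (n + 1) →
                  FrameOK R U (nScales β) μ (klFlowFrameU L M β U μ (n + 1)) →
                    (∀ j ≤ n + 1, LevelsUExportMixedAt L M (klCU2 P R Q₀) P β U μ j) →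
                      PairTransferRelFamilyK5 L M G P r β U μ n → PairTransferRelFamilyK5 L M G P r β U μ (n + 1)) :
    PairTransferStep6 P R Q₀ G r u := by
  intro hG Q hQ cc hcc0 hcc μ hμ U hU hU10 hUu β hβ hβc L M _ _ hL hM n hn hreg hhist hK hlev hfam
  cases n with
  | zero => exact hbase hG Q hQ cc hcc0 hcc μ hμ U hU hU10 hUu β hβ hβc L M hL hM hn hreg hhist hK hlev
  | succ n => exact hsucc hG Q hQ cc hcc0 hcc μ hμ U hU hU10 hUu β hβ hβc L M hL hM n hn hreg hhist hK hlev (hfam n (Nat.lt_succ_self n))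

end Step6

/-! ## §2 `PairTransferStep6` from a PRIVATE invariant at the package `G` -/

section Private

set_option maxHeartbeats 800000 in -- long binder lists; plumbing
/-- **`pairTransferStep6_of_private`** — `PairTransferStep6 P R Q₀ G r u` from a private invariant `Priv Q cc μ U β L M n` with BASE / STEP / EXPORT clauses under Step6's
binders AT `G` (the Export6 twin of `pairTransferStep5_of_private`; the handed history `∀ j < n, …K5 j` is not read). -/
theorem pairTransferStep6_of_private {P : SplitConsts} {R : RenConsts} {Q₀ : EngConsts} {G : GeoConsts} {r : ℝ} {u : EngConsts → ℝ → ℝ} (hR : R.WF2)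
    (h0 : ∀ (U μ β : ℝ), μ ∈ klWindowC → FrameOK R U (nScales β) μ 0) (Priv : EngConsts → ℝ → ℝ → ℝ → ℝ → ℕ → ℕ → ℕ → Prop)
    (hbase : G.WF → ∀ Q : EngConsts, Q₀.IsRaiseOf Q →
      ∀ cc : ℝ, 0 < cc → cc ≤ klEngC₃6 P R →
        ∀ μ ∈ klWindowC, ∀ U : ℝ, 0 < U → U ≤ klEngU₀10 P R cc → U ≤ u Q cc →
          ∀ β : ℝ, klBetaMin ≤ β → β ≤ Real.exp (cc / U ^ 2) →
            ∀ (L M : ℕ) [NeZero L] [NeZero M], klEngL₄ P R β U ≤ L → klEngM₃ β U L ≤ M →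
              0 ≤ nScales β + 1 → IsKLRegime U cc (-((0 : ℕ) : ℤ)) →
                HistP klPredsV17F2 L M G P Q R β U μ 0 (0) →
                  FrameOK R U (nScales β) μ (klFlowFrameU L M β U μ (0)) →
                    (∀ j ≤ 0, LevelsUExportMixedAt L M (klCU2 P R Q₀) P β U μ j) →
                      Priv Q cc μ U β L M 0)
    (hsucc : G.WF → ∀ Q : EngConsts, Q₀.IsRaiseOf Q →
      ∀ cc : ℝ, 0 < cc → cc ≤ klEngC₃6 P R →
        ∀ μ ∈ klWindowC, ∀ U : ℝ, 0 < U → U ≤ klEngU₀10 P R cc → U ≤ u Q cc →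
          ∀ β : ℝ, klBetaMin ≤ β → β ≤ Real.exp (cc / U ^ 2) →
            ∀ (L M : ℕ) [NeZero L] [NeZero M], klEngL₄ P R β U ≤ L → klEngM₃ β U L ≤ M →
              ∀ n : ℕ, n + 1 ≤ nScales β + 1 → IsKLRegime U cc (-((n + 1 : ℕ) : ℤ)) →
                HistP klPredsV17F2 L M G P Q R β U μ 0 (n + 1) →
                  FrameOK R U (nScales β) μ (klFlowFrameU L M β U μ (n + 1)) →
                    (∀ j ≤ n + 1, LevelsUExportMixedAt L M (klCU2 P R Q₀) P β U μ j) →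
                      Priv Q cc μ U β L M n → Priv Q cc μ U β L M (n + 1))
    (hexport : G.WF → ∀ Q : EngConsts, Q₀.IsRaiseOf Q →
      ∀ cc : ℝ, 0 < cc → cc ≤ klEngC₃6 P R →
        ∀ μ ∈ klWindowC, ∀ U : ℝ, 0 < U → U ≤ klEngU₀10 P R cc → U ≤ u Q cc →
          ∀ β : ℝ, klBetaMin ≤ β → β ≤ Real.exp (cc / U ^ 2) →
            ∀ (L M : ℕ) [NeZero L] [NeZero M], klEngL₄ P R β U ≤ L → klEngM₃ β U L ≤ M →
              ∀ n : ℕ, n ≤ nScales β + 1 → IsKLRegime U cc (-((n : ℕ) : ℤ)) →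
                HistP klPredsV17F2 L M G P Q R β U μ 0 (n) →
                  FrameOK R U (nScales β) μ (klFlowFrameU L M β U μ (n)) →
                    (∀ j ≤ n, LevelsUExportMixedAt L M (klCU2 P R Q₀) P β U μ j) →
                      Priv Q cc μ U β L M n → PairTransferRelFamilyK5 L M G P r β U μ n) :
    PairTransferStep6 P R Q₀ G r u := by
  intro hG Q hQ cc hcc0 hcc μ hμ U hU hU10 hUu β hβ hβc L M _ _ hL hM n hn hreg hhist hK hlev _hfam
  have h0' : FrameOK R U (nScales β) μ 0 := h0 U μ β hμ
  -- every `j ≤ n` carries the binders at `j`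
  have hregj : ∀ j ≤ n, IsKLRegime U cc (-((j : ℕ) : ℤ)) := fun j hj => isKLRegime_of_le_nScales_succ hcc0.le hβ hβc (hj.trans hn)
  have hhistj : ∀ j ≤ n, HistP klPredsV17F2 L M G P Q R β U μ 0 j := fun j hj => histP_klPredsV17F2_of_le hhist hj
  have hKj : ∀ j ≤ n, FrameOK R U (nScales β) μ (klFlowFrameU L M β U μ j) := fun j hj =>
    frameOK_klFlowFrameU_of_histP hR h0' (hj.trans hn) (hhistj j hj)
  -- the private invariant at every `j ≤ n`, by induction
  have hpriv : ∀ j ≤ n, Priv Q cc μ U β L M j := by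
    intro j
    induction j with
    | zero =>
        intro hj
        exact hbase hG Q hQ cc hcc0 hcc μ hμ U hU hU10 hUu β hβ hβc L M hL hM (hj.trans hn) (hregj 0 hj) (hhistj 0 hj) (hKj 0 hj)
          (fun i hi => hlev i (hi.trans hj))
    | succ j ih =>
        intro hj
        exact hsucc hG Q hQ cc hcc0 hcc μ hμ U hU hU10 hUu β hβ hβc L M hL hM j (hj.trans hn) (hregj _ hj) (hhistj _ hj) (hKj _ hj)
          (fun i hi => hlev i (hi.trans hj)) (ih ((Nat.le_succ j).trans hj))
  exact hexport hG Q hQ cc hcc0 hcc μ hμ U hU hU10 hUu β hβ hβc L M hL hM n hn hreg hhist hK hlev (hpriv n le_rfl)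

end Private

/-! ## §3 The (X).3 conjunct from a capped witness -/

section Exists

/-- **`exists_isTransferPkg6_of_step6`** — stub (X).3's class-#5 conjunct (rev 12 «…-CAP6» shape) from a CAPPED witness: `0 ≤ r ≤ klCTcap`, a positive coupling threshold
`u`, and the G-parametric step at `(r, u)`. -/
theorem exists_isTransferPkg6_of_step6 {P : SplitConsts} {R : RenConsts} {Q₀ : EngConsts} {G : GeoConsts} {r : ℝ} {u : EngConsts → ℝ → ℝ}
    (hr : 0 ≤ r) (hrc : r ≤ klCTcap) (hu : ∀ Q cc, 0 < u Q cc) (h : PairTransferStep6 P R Q₀ G r u) :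
    ∃ e : ℝ × (EngConsts → ℝ → ℝ), IsTransferPkg6 e ∧ PairTransferStep6 P R Q₀ G e.1 e.2 :=
  ⟨(r, u), ⟨hr, hrc, hu⟩, h⟩

end Exists

end Summit.HubbardSuperconductivity.HubbardSuperconductivity.Theorems.KLRegimeSplit

end
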